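import Mathlib

/-!
# Solo-blind: the SMALL-P end of (P⁺)_F as an analytic Kato lemma (closing the residual P ∈ (0, .0015])

Setting (paper §24.93(2),(6); U16r carrier §106(f), kit j341430).  `M(P)` is the leaf monodromy of the
truncated chain, entire in `P`; at `P = 0` the chain is decoupled and `1` is an eigenvalue of `M(0)` of
geometric multiplicity two (m = 0 streak ⊕ m = 1 pattern mode, algebraic marginality `K₀(m²−1) = 0`).
In block coordinates `V = [Q₁ | Q_k]` (ANY invertible `V`; the engine's is a float SVD basis),
`A(P) = 1 − V⁻¹M(P)V = [[A₁₁, A₁₂], [A₂₁, A₂₂]]` with `A₂₂(P)` invertible for `|P| ≤ s`.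

The point of this file: the Schur complement `S(P) = A₁₁ − A₁₂ A₂₂⁻¹ A₂₁` vanishes EXACTLY at `P = 0` as
soon as the kernel of `A(0)` projects onto the top block (`schur_eq_zero_of_kernel_projects`,
`kernel_bottom_of_top`, `kernel_projects_of_two`): no information about how well the float basis deflates is
needed.  Hence `S(P) = −P·(G − W(P)/P)` with `‖W(P)‖ ≤ P w₁ + P² w₂`, and `σ_min(G) > w₁ + s w₂` gives
`‖S(P)⁻¹‖ ≤ 1/((σ_min(G) − ω) P)` on the WHOLE interval `(0, s]` — including the residual `(0, .0015]` that the
grid certificate (P_a = s/100) left open.  `smallP_rate_uniform` records the monotonicity in `P`;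
`smallP_U16r_constants` checks the arithmetic with the certified constants of j341430 (s = .15, J = 12):
head constant ≤ 4.0306, times κ(V) ≤ 8.327 ≤ 10.507 (the engine's constant on [.0015, .15]), so
`‖(1 − M_N(P))⁻¹‖₂ ≤ 10.507/P` for all `P ∈ (0, .15]`, `N ≥ 12` (tail scaling as in 24.93(6)(b)).
-/

namespace Summit.AnomalousDissipation.AnomalousDissipation.Theorems

open Matrix

section Schur

variable {m n : Type*} [Fintype m] [Fintype n]

/-- Block kernel equations: if `[[A,B],[C,D]] (x,y) = 0` with `D` invertible then `y = −D⁻¹ C x` and the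
Schur complement annihilates `x`. -/
theorem kernel_bottom_of_top [DecidableEq n] (A : Matrix m m ℝ) (B : Matrix m n ℝ) (C : Matrix n m ℝ)
    (D : Matrix n n ℝ) [Invertible D] (x : m → ℝ) (y : n → ℝ)
    (h : (fromBlocks A B C D) *ᵥ (Sum.elim x y) = 0) :
    y = -((⅟D * C) *ᵥ x) ∧ (A - B * ⅟D * C) *ᵥ x = 0 := by
  rw [fromBlocks_mulVec] at h
  have h1 : A *ᵥ x + B *ᵥ y = 0 := by
    funext i; have := congrFun h (Sum.inl i); simpa using this
  have h2 : C *ᵥ x + D *ᵥ y = 0 := by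
    funext j; have := congrFun h (Sum.inr j); simpa using this
  have hy : y = -((⅟D * C) *ᵥ x) := by
    have hDy : D *ᵥ y = -(C *ᵥ x) := by
      rw [← sub_eq_zero, sub_neg_eq_add, add_comm]; exact h2
    calc y = (⅟D * D) *ᵥ y := by rw [invOf_mul_self, one_mulVec]
      _ = ⅟D *ᵥ (D *ᵥ y) := by rw [mulVec_mulVec]
      _ = -((⅟D * C) *ᵥ x) := by rw [hDy, mulVec_neg, mulVec_mulVec]
  refine ⟨hy, ?_⟩
  rw [sub_mulVec, ← mulVec_mulVec, ← mulVec_mulVec]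
  rw [hy, mulVec_neg, ← mulVec_mulVec] at h1
  rw [sub_eq_add_neg]; exact h1

/-- If the kernel of the block matrix projects ONTO the top block (for every `x` there is a `y` with
`[[A,B],[C,D]](x,y) = 0`) and `D` is invertible, the Schur complement is identically zero. -/
theorem schur_eq_zero_of_kernel_projects [DecidableEq m] [DecidableEq n] (A : Matrix m m ℝ)
    (B : Matrix m n ℝ) (C : Matrix n m ℝ) (D : Matrix n n ℝ) [Invertible D]
    (h : ∀ x : m → ℝ, ∃ y : n → ℝ, (fromBlocks A B C D) *ᵥ (Sum.elim x y) = 0) :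
    A - B * ⅟D * C = 0 := by
  have hS : ∀ x : m → ℝ, (A - B * ⅟D * C) *ᵥ x = 0 := fun x => by
    obtain ⟨y, hy⟩ := h x
    exact (kernel_bottom_of_top A B C D x y hy).2
  ext i j
  have := congrFun (hS (Pi.single j 1)) i
  simpa [mulVec, dotProduct, Pi.single_apply] using this

/-- Kernel vectors combine linearly (used to pass from two independent neutral modes to the projection
hypothesis of `schur_eq_zero_of_kernel_projects`). -/
theorem kernel_projects_of_two (M : Matrix (m ⊕ n) (m ⊕ n) ℝ) (x₁ x₂ : m → ℝ) (y₁ y₂ : n → ℝ)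
    (h₁ : M *ᵥ (Sum.elim x₁ y₁) = 0) (h₂ : M *ᵥ (Sum.elim x₂ y₂) = 0)
    (hspan : ∀ x : m → ℝ, ∃ a b : ℝ, x = a • x₁ + b • x₂) :
    ∀ x : m → ℝ, ∃ y : n → ℝ, M *ᵥ (Sum.elim x y) = 0 := by
  intro x
  obtain ⟨a, b, rfl⟩ := hspan x
  refine ⟨a • y₁ + b • y₂, ?_⟩
  have hsum : Sum.elim (a • x₁ + b • x₂) (a • y₁ + b • y₂) = a • Sum.elim x₁ y₁ + b • Sum.elim x₂ y₂ := by
    funext i; cases i <;> simp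
  rw [hsum, mulVec_add, mulVec_smul, mulVec_smul, h₁, h₂, smul_zero, smul_zero, add_zero]

/-- In the top block `m = Fin 2`: two vectors with non-vanishing determinant span. -/
theorem span_of_det_ne_zero (x₁ x₂ : Fin 2 → ℝ) (hdet : x₁ 0 * x₂ 1 - x₁ 1 * x₂ 0 ≠ 0) :
    ∀ x : Fin 2 → ℝ, ∃ a b : ℝ, x = a • x₁ + b • x₂ := by
  intro x
  set d := x₁ 0 * x₂ 1 - x₁ 1 * x₂ 0 with hd
  refine ⟨(x 0 * x₂ 1 - x 1 * x₂ 0) / d, (x₁ 0 * x 1 - x₁ 1 * x 0) / d, ?_⟩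
  funext i
  fin_cases i <;> simp <;> field_simp <;> ring

end Schur

/-- Uniformity in `P`: with `‖W(P)‖ ≤ P w₁ + P² w₂` and `ω ≥ w₁ + s w₂`, the Neumann margin `σ − (w₁ + P w₂)`
is at least `σ − ω` on all of `(0, s]`, so a bound of the form `‖S(P)⁻¹‖ ≤ 1/((σ − w₁ − P w₂) P)` is at most
`1/((σ − ω) P)` there — the supremum sits at `P = s`, nothing degenerates as `P → 0`. -/
theorem smallP_rate_uniform {σ ω w₁ w₂ s P : ℝ} (hw₂ : 0 ≤ w₂) (hP : 0 < P) (hPs : P ≤ s)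
    (hω : w₁ + s * w₂ ≤ ω) (hσ : ω < σ) :
    0 < σ - (w₁ + P * w₂) ∧ 1 / ((σ - (w₁ + P * w₂)) * P) ≤ 1 / ((σ - ω) * P) := by
  have h1 : w₁ + P * w₂ ≤ ω := le_trans (by nlinarith) hω
  have h2 : 0 < σ - ω := by linarith
  have h3 : σ - ω ≤ σ - (w₁ + P * w₂) := by linarith
  refine ⟨lt_of_lt_of_le h2 h3, ?_⟩
  apply one_div_le_one_div_of_le (mul_pos h2 hP)
  exact mul_le_mul_of_nonneg_right h3 hP.le

/-- The certified constants of kit j341430 (U16r carrier, J = 12, Taylor box s = .15; every number an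
outward-rounded certificate value printed by the engine): κ(V), θ₂, a₂₂ = ‖A₂₂(P)⁻¹‖, e₁₁, e₁₂, e₂₁,
‖T₀¹²‖, ‖T₀²¹‖, σ_max(G), det G − (its radius).  Conclusions: ω = w₁ + s w₂ ≤ .02696 < .31149 ≤ σ_min(G)
(= det G/σ_max(G) for a 2×2 matrix); 1/(σ_min − ω) ≤ 3.5146; head constant
`3.5146·(1 + a₂₂(‖T₀¹²‖ + s e₁₂))(1 + a₂₂(‖T₀²¹‖ + s e₂₁)) + a₂₂ s ≤ 4.0306`; `κ(V)·4.0306 ≤ 8.327 ≤ 10.507`. -/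
theorem smallP_U16r_constants :
    let s : ℝ := 0.15
    let kap : ℝ := 2.0659420679966174
    let th2 : ℝ := 0.006441033951104107
    let a22 : ℝ := 1.205499855531354
    let e11 : ℝ := 0.10088416177229385
    let e12 : ℝ := 0.2255965834498051
    let e21 : ℝ := 0.2897658647979687
    let n012 : ℝ := 3.194540130476751e-10
    let n021 : ℝ := 1.1538924103758226e-10
    let nG : ℝ := 0.5955649505391631
    let detGlo : ℝ := 0.1855159867 - 7.40e-11
    let w1 : ℝ := a22 * (n012 * n021 * th2 / s + e12 * n021 + n012 * e21)
    let w2 : ℝ := e11 + a22 * e12 * e21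
    w1 + s * w2 ≤ 0.02696 ∧ 0.31149 ≤ detGlo / nG ∧ 1 / (0.31149 - 0.02696) ≤ (3.5146 : ℝ) ∧
      3.5146 * (1 + a22 * (n012 + s * e12)) * (1 + a22 * (n021 + s * e21)) + a22 * s ≤ 4.0306 ∧
      kap * 4.0306 ≤ 8.327 ∧ (8.327 : ℝ) ≤ 10.507 := by
  simp only
  refine ⟨by norm_num, by norm_num, by norm_num, by norm_num, by norm_num, by norm_num⟩

end Summit.AnomalousDissipation.AnomalousDissipation.Theorems
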